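import Summits.Ventures.CertifiedManyBodySolver.Downfold.PressureAxisBox
import HarnessLib

/-!
# The router word along the whole computed pressure RANGE of a material, I: grid cover, the
# padded hull record, the P.12(e) certificate of a sub-interval

Venture CertifiedManyBodySolver, cell `pub/hubbard-downfold` (S1 = downfolding front end = ROUTER),
seat hubbard-downfold-mod-2; namespaces `Summit.Ventures.CertifiedManyBodySolver.Downfold`
(`.Inflation`: the order-theoretic cover; `.Skel`: the padded hull skeleton; `.Router`: certificates
and words). HUMAN RULING D-0099 asks for a phase map «along this range of pressures»: S1 computes a
parameter box at finitely many pressures `a 0 < a 1 < … < a n` of a material and the files of record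
`router/P-INTERVALS.tsv` / `router/P-CONTINUUM.tsv` print, for every open sub-interval
`(a k, a (k+1))`, either an «interpolated (P.12e)» word or «undetermined». `Downfold.PressureAxis` /
`PressureAxisBox` prove what ONE sub-interval inherits from its two end-point boxes. This file is
the assembly over the GRID:

* §1 `Inflation.exists_mem_Icc_succ` / `forall_Icc_of_forall_Icc_succ` — a computed range
  `[a i, a j]` is covered by its consecutive sub-intervals `[a k, a (k+1)]`, `i ≤ k < j` (no
  monotonicity of the grid needed); `forall_Icc_of_forall_Icc_two` is the two-piece cover behind
  the «two-structure coverage» reading §P.12(h″) (a word proved on `[a, m]` and on `[m, b]` holds on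
  `[a, b]`); `mem_Icc_near_ends_of_abs_deriv_le` / `_of_monotoneOn_or_antitoneOn` / `_mono` — the
  per-coordinate NEAR-ENDS bracket `f u ∈ [min (f a) (f b) - q, max (f a) (f b) + q]` (`q = S L / 2`
  from the sensitivity bound `|f'| ≤ S`, any `q ≥ 0` for a sign-definite coordinate, monotone in
  `q`) = the input of the padded record of §2.
* §2 `Skel.hullPad S₁ S₂ pad` — the coordinatewise PADDED hull record (the hull of the two end-point
  enclosures inflated by `pad i`; `pad i = 0` on sign-definite coordinates, `pad i = S_i · L / 2` on
  a coordinate without a sign, §P.12(b)); `Skel.mem_hullPad_of_near_ends`: a vector every coordinate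
  of which lies within `pad i` of the hull of the two end values is admitted — the per-coordinate
  enclosures of `PressureAxis` §1 (`mem_Icc_of_monotoneOn`, `mem_Icc_interp_half_of_abs_deriv_le`)
  assembled into ONE skeleton statement.
* §3 `Router.IntervalCert S₁ S₂ H p a b r` — THE P.12(e) CERTIFICATE of the sub-interval `[a, b]`:
  an interval record `H` inflating both point skeletons, admitting the parameter path `p u` at every
  `u ∈ [a, b]`, on which the row `r` fires. Consequences: the row holds on `[a, b]` (`sat`); the row
  fires at BOTH computed points, so for a consistent table the routed word of each end column IS
  the interval word (`route_left` / `route_right` — the `end_words = interval_word` invariant of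
  `P-INTERVALS.tsv` is a theorem of the certificate, not a file convention). Constructors:
  `of_fires_ends` (sign-definite coordinates, row firing at both ends — `Row.sat_on_Icc_of_monotone`
  repackaged), `of_fires_hull`, `of_near_ends` (padded record), `of_box_hull` (mod-1's `Box.hull`).
* `ReachCert` is the one-sided analogue (§P.12(c′); `ReachCert.route_point`). The CONTINUUM proper —
  words at a vector, junctions of certified sub-intervals, maximal decided runs, the (h″) coverage
  statement — is `Downfold.PressureContinuumRuns` (split for the 400-line rule).

Everything is PROVED (the tree's `RouterWindows`, `RouterWord`, `PressureAxis`, `PressureAxisBox`,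
`IntervalCalculus`; Mathlib order lemmas). WHAT THIS IS NOT: a statement about any material, a value
of a pad or a sensitivity class, or a claim that a path IS monotone / Lipschitz in the volume — those
are the modelling inputs of `router/INFLATION-RULES.md` §P; the point boxes are SYSTEMATIC
(screening-grade) claims and an «interpolated» word inherits exactly their standing, never more.
-/

open Set

namespace Summit.Ventures.CertifiedManyBodySolver.Downfold

open NonemptyInterval

/-! ## §1 Grid cover: a computed range is the union of its consecutive sub-intervals -/

namespace Inflation

variable {α : Type*} [LinearOrder α]

/-- **Two-piece cover.** A property holding on `[a, m]` and on `[m, b]` holds on `[a, b]` (the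
kernel of the «two-structure coverage» reading §P.12(h″): each structure's span is covered from the
end column that computed it). [folklore] -/
theorem forall_Icc_of_forall_Icc_two {Q : α → Prop} {a m b : α} (h₁ : ∀ u ∈ Icc a m, Q u)
    (h₂ : ∀ u ∈ Icc m b, Q u) : ∀ u ∈ Icc a b, Q u := by
  intro u hu
  rcases le_or_gt u m with hum | hmu
  · exact h₁ u ⟨hu.1, hum⟩
  · exact h₂ u ⟨hmu.le, hu.2⟩

/-- **Grid cover.** A point of the computed range `[a i, a j]` (`i < j`) lies in some consecutive
sub-interval `[a k, a (k+1)]` with `i ≤ k < j` — for ANY sequence `a` (no monotonicity needed).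
[folklore] -/
theorem exists_mem_Icc_succ {a : ℕ → α} {i j : ℕ} (hij : i < j) {u : α}
    (hu : u ∈ Icc (a i) (a j)) : ∃ k, i ≤ k ∧ k < j ∧ u ∈ Icc (a k) (a (k + 1)) := by
  induction j with
  | zero => exact absurd hij (Nat.not_lt_zero _)
  | succ j ih =>
    rcases (Nat.lt_succ_iff.1 hij).lt_or_eq with hlt | rfl
    · rcases le_or_gt u (a j) with huj | hju
      · obtain ⟨k, hik, hkj, hk⟩ := ih hlt ⟨hu.1, huj⟩
        exact ⟨k, hik, Nat.lt_succ_of_lt hkj, hk⟩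
      · exact ⟨j, hlt.le, Nat.lt_succ_self _, hju.le, hu.2⟩
    · exact ⟨i, le_rfl, Nat.lt_succ_self _, hu⟩

/-- **A property holding on every consecutive sub-interval holds on the whole computed range.**
[folklore] -/
theorem forall_Icc_of_forall_Icc_succ {Q : α → Prop} {a : ℕ → α} {i j : ℕ} (hij : i < j)
    (h : ∀ k, i ≤ k → k < j → ∀ u ∈ Icc (a k) (a (k + 1)), Q u) :
    ∀ u ∈ Icc (a i) (a j), Q u := fun u hu => by
  obtain ⟨k, hik, hkj, hk⟩ := exists_mem_Icc_succ hij hu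
  exact h k hik hkj u hk

/-! ### The near-ends bracket of one coordinate (the per-coordinate input of the padded record) -/

/-- **Near-ends bracket from the sensitivity bound.** `f` continuous on `[a, b]`, `|f'| ≤ S` on
`(a, b)`, `0 ≤ S` ⇒ `f u ∈ [min (f a) (f b) - S (b - a) / 2, max (f a) (f b) + S (b - a) / 2]` for
every `u ∈ [a, b]` (`mem_Icc_interp_half_of_abs_deriv_le` at the point boxes `[f a, f a]`,
`[f b, f b]`). [folklore] -/
theorem mem_Icc_near_ends_of_abs_deriv_le {f f' : ℝ → ℝ} {a b S u : ℝ}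
    (hcont : ContinuousOn f (Icc a b)) (hder : ∀ x ∈ Ioo a b, HasDerivAt f (f' x) x)
    (hS : ∀ x ∈ Ioo a b, |f' x| ≤ S) (hS0 : 0 ≤ S) (hu : u ∈ Icc a b) :
    f u ∈ Icc (min (f a) (f b) - S * ((b - a) / 2)) (max (f a) (f b) + S * ((b - a) / 2)) :=
  mem_Icc_interp_half_of_abs_deriv_le hcont hder hS hS0 ⟨le_rfl, le_rfl⟩ ⟨le_rfl, le_rfl⟩ hu

/-- **Near-ends bracket of a sign-definite coordinate**: monotone or antitone on `[a, b]` ⇒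
`f u ∈ [min (f a) (f b) - q, max (f a) (f b) + q]` for any pad `q ≥ 0` (pad `0` suffices).
[folklore] -/
theorem mem_Icc_near_ends_of_monotoneOn_or_antitoneOn {f : ℝ → ℝ} {a b u q : ℝ} (hq : 0 ≤ q)
    (hm : MonotoneOn f (Icc a b) ∨ AntitoneOn f (Icc a b)) (hu : u ∈ Icc a b) :
    f u ∈ Icc (min (f a) (f b) - q) (max (f a) (f b) + q) := by
  rcases hm with hm | hm
  · obtain ⟨l, r⟩ := mem_Icc_of_monotoneOn hm hu
    exact ⟨by linarith [min_le_left (f a) (f b)], by linarith [le_max_right (f a) (f b)]⟩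
  · obtain ⟨l, r⟩ := mem_Icc_of_antitoneOn hm hu
    exact ⟨by linarith [min_le_right (f a) (f b)], by linarith [le_max_left (f a) (f b)]⟩

/-- A near-ends bracket persists under a LARGER pad (the printed pad `S_class · L / 2` may exceed
the coordinate's own). [folklore] -/
theorem mem_Icc_near_ends_mono {x lo hi q q' : ℝ} (hqq' : q ≤ q') (h : x ∈ Icc (lo - q) (hi + q)) :
    x ∈ Icc (lo - q') (hi + q') :=
  ⟨by linarith [h.1], by linarith [h.2]⟩

end Inflation

/-! ## §2 The padded hull skeleton -/

namespace Skel

variable {ι : Type*} {K : Type*} [Field K] [LinearOrder K] [IsStrictOrderedRing K]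

/-- **The PADDED hull record of two point skeletons**: on a coordinate present in both, the interval
hull of the two enclosures inflated by the radius `pad i` (`0` on a sign-definite coordinate,
`S · L / 2` on a coordinate without a sign, §P.12(b)); absent elsewhere. [folklore] -/
def hullPad (S₁ S₂ : Skel ι) (pad : ι → ℚ≥0) : Skel ι := fun i =>
  match S₁ i, S₂ i with
  | some I, some J => some ((I ⊔ J).inflate (pad i))
  | _, _ => none

/-- The padded hull's entry at `i`: present iff present in both, and then the inflated hull.
[folklore] -/
theorem hullPad_eq_some_iff {S₁ S₂ : Skel ι} {pad : ι → ℚ≥0} {i : ι} {L : NonemptyInterval ℚ} :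
    S₁.hullPad S₂ pad i = some L ↔
      ∃ I J, S₁ i = some I ∧ S₂ i = some J ∧ (I ⊔ J).inflate (pad i) = L := by
  unfold hullPad
  rcases h1 : S₁ i with _ | I <;> rcases h2 : S₂ i with _ | J <;> simp

/-- The padded hull inflates the plain hull. [folklore] -/
theorem hull_incl_hullPad (S₁ S₂ : Skel ι) (pad : ι → ℚ≥0) :
    (S₁.hull S₂).Incl (S₁.hullPad S₂ pad) := by
  intro i L hL
  obtain ⟨I, J, hI, hJ, rfl⟩ := hullPad_eq_some_iff.1 hL
  exact ⟨I ⊔ J, hull_eq_some_iff.2 ⟨I, J, hI, hJ, rfl⟩, le_inflate _ _⟩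

/-- The padded hull inflates the left point skeleton. [folklore] -/
theorem incl_hullPad_left (S₁ S₂ : Skel ι) (pad : ι → ℚ≥0) : S₁.Incl (S₁.hullPad S₂ pad) :=
  (incl_hull_left S₁ S₂).trans (hull_incl_hullPad S₁ S₂ pad)

/-- The padded hull inflates the right point skeleton. [folklore] -/
theorem incl_hullPad_right (S₁ S₂ : Skel ι) (pad : ι → ℚ≥0) : S₂.Incl (S₁.hullPad S₂ pad) :=
  (incl_hull_right S₁ S₂).trans (hull_incl_hullPad S₁ S₂ pad)

/-- Membership in the padded hull, coordinate by coordinate. [folklore] -/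
theorem mem_hullPad_of_coords {S₁ S₂ : Skel ι} {pad : ι → ℚ≥0} {p : ι → K}
    (h : ∀ i I J, S₁ i = some I → S₂ i = some J → p i ∈ ((I ⊔ J).inflate (pad i)).ratCast K) :
    (S₁.hullPad S₂ pad).Mem p := by
  intro i L hL
  obtain ⟨I, J, hI, hJ, rfl⟩ := hullPad_eq_some_iff.1 hL
  exact h i I J hI hJ

/-- **The padded hull admits every vector near the hull of two admitted vectors.** `S₁` admits `x`,
`S₂` admits `y`, and on every coordinate present in both `q i ∈ [min (x i) (y i) - pad i,
max (x i) (y i) + pad i]` ⇒ the padded hull admits `q`. With `x = p a`, `y = p b` (the true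
parameters at the two computed pressures) and `q = p u` this is the interval-box enclosure of
§P.12: the bracket is discharged per coordinate by monotonicity (`pad i = 0`,
`Inflation.mem_Icc_of_monotoneOn`) or by the sensitivity bound
(`Inflation.mem_Icc_interp_half_of_abs_deriv_le`, `pad i = S (b - a) / 2`). [cite: Moore1966, Ch. 2] -/
theorem mem_hullPad_of_near_ends {S₁ S₂ : Skel ι} {pad : ι → ℚ≥0} {x y q : ι → K}
    (hx : S₁.Mem x) (hy : S₂.Mem y)
    (h : ∀ i I J, S₁ i = some I → S₂ i = some J →
      q i ∈ Icc (min (x i) (y i) - ((pad i : ℚ) : K)) (max (x i) (y i) + ((pad i : ℚ) : K))) :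
    (S₁.hullPad S₂ pad).Mem q :=
  mem_hullPad_of_coords fun i I J hI hJ =>
    mem_ratCast_sup_inflate_of_mem_Icc (hx i I hI) (hy i J hJ) (h i I J hI hJ)

/-- **The plain hull admits a monotone path** (sign-definite coordinates): `S₁` admits `p a`, `S₂`
admits `p b`, every coordinate present in both monotone or antitone on `[a, b]` ⇒ the hull admits
`p u` for every `u ∈ [a, b]`. [folklore] -/
theorem mem_hull_on_Icc_of_monotone {S₁ S₂ : Skel ι} {p : ℝ → ι → ℝ} {a b : ℝ}
    (hmono : ∀ i I J, S₁ i = some I → S₂ i = some J →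
      MonotoneOn (fun u => p u i) (Icc a b) ∨ AntitoneOn (fun u => p u i) (Icc a b))
    (ha : S₁.Mem (p a)) (hb : S₂.Mem (p b)) : ∀ u ∈ Icc a b, (S₁.hull S₂).Mem (p u) := by
  intro u hu
  refine mem_hull_of_coords fun i I J hI hJ => ?_
  refine mem_ratCast_sup_of_mem_Icc (ha i I hI) (hb i J hJ) ?_
  rcases hmono i I J hI hJ with hm | hm
  · obtain ⟨l, r⟩ := Inflation.mem_Icc_of_monotoneOn hm hu
    exact ⟨(min_le_left _ _).trans l, r.trans (le_max_right _ _)⟩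
  · obtain ⟨l, r⟩ := Inflation.mem_Icc_of_antitoneOn hm hu
    exact ⟨(min_le_right _ _).trans l, r.trans (le_max_left _ _)⟩

end Skel

/-! ## §3 The P.12(e) certificate of one sub-interval -/

namespace Router

variable {ι : Type*} {ω : Type*}

/-- **A word certificate on a pressure segment**: an interval record `H` admitting the parameter
path at every pressure of `[a, b]`, and a row firing on `H`. [folklore] -/
@[folklore]
structure SegCert (H : Skel ι) (p : ℝ → ι → ℝ) (a b : ℝ) (r : Row ι ω) : Prop where
  /-- the record admits the path on the segment -/
  path : ∀ u ∈ Icc a b, H.Mem (p u)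
  /-- the row fires on the record -/
  fires : r.fires H = true

/-- A certified row holds at every pressure of the segment. [folklore] -/
theorem SegCert.sat {H : Skel ι} {p : ℝ → ι → ℝ} {a b : ℝ} {r : Row ι ω}
    (c : SegCert H p a b r) : ∀ u ∈ Icc a b, r.Sat (p u) :=
  fun u hu => Row.fires_sound c.fires (c.path u hu)

/-- **THE P.12(e) CERTIFICATE of the sub-interval `[a, b]` between two computed pressures**: an
interval record `H` (the hull of the two point skeletons, the padded hull, or the skeleton of a
`Box.hull`) that inflates BOTH point skeletons `S₁ ∋ p a`, `S₂ ∋ p b`, admits the path on `[a, b]`,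
and on which the row `r` fires. [folklore] -/
@[folklore]
structure IntervalCert (S₁ S₂ H : Skel ι) (p : ℝ → ι → ℝ) (a b : ℝ) (r : Row ι ω) : Prop
    extends SegCert H p a b r where
  /-- the record inflates the left point skeleton -/
  incl_left : S₁.Incl H
  /-- the record inflates the right point skeleton -/
  incl_right : S₂.Incl H

/-- **A ONE-SIDED (reach) certificate** (§P.12(c′)): a record `H` inflating the point skeleton `S`
of the last computed pressure, admitting the path on the reach `[a, b]`, on which `r` fires.
[folklore] -/
@[folklore]
structure ReachCert (S H : Skel ι) (p : ℝ → ι → ℝ) (a b : ℝ) (r : Row ι ω) : Prop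
    extends SegCert H p a b r where
  /-- the record inflates the computed point's skeleton -/
  incl : S.Incl H

namespace IntervalCert

variable {S₁ S₂ H : Skel ι} {p : ℝ → ι → ℝ} {a b : ℝ} {r : Row ι ω}

/-- The certified row fires on the LEFT point box. [folklore] -/
theorem fires_left (c : IntervalCert S₁ S₂ H p a b r) : r.fires S₁ = true :=
  Row.fires_mono c.incl_left c.fires

/-- The certified row fires on the RIGHT point box. [folklore] -/
theorem fires_right (c : IntervalCert S₁ S₂ H p a b r) : r.fires S₂ = true :=
  Row.fires_mono c.incl_right c.fires

/-- **The left end column's routed word IS the interval word** (consistent table). [folklore] -/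
theorem route_left {T : List (Row ι ω)} (hT : Consistent T) (hr : r ∈ T)
    (c : IntervalCert S₁ S₂ H p a b r) : route T S₁ = .table r.out :=
  route_table_of_fires hT hr c.fires_left

/-- **The right end column's routed word IS the interval word** (consistent table). [folklore] -/
theorem route_right {T : List (Row ι ω)} (hT : Consistent T) (hr : r ∈ T)
    (c : IntervalCert S₁ S₂ H p a b r) : route T S₂ = .table r.out :=
  route_table_of_fires hT hr c.fires_right

/-- The interval record itself is routed to the interval word. [folklore] -/
theorem route_record {T : List (Row ι ω)} (hT : Consistent T) (hr : r ∈ T)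
    (c : IntervalCert S₁ S₂ H p a b r) : route T H = .table r.out :=
  route_table_of_fires hT hr c.fires

/-- The two one-sided certificates an interval certificate contains. [folklore] -/
theorem reach_left (c : IntervalCert S₁ S₂ H p a b r) : ReachCert S₁ H p a b r :=
  ⟨c.toSegCert, c.incl_left⟩

/-- The two one-sided certificates an interval certificate contains (right end). [folklore] -/
theorem reach_right (c : IntervalCert S₁ S₂ H p a b r) : ReachCert S₂ H p a b r :=
  ⟨c.toSegCert, c.incl_right⟩

/-- **Constructor — sign-definite coordinates, row firing at BOTH computed points** (§P.12(a)+(e);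
`Row.sat_on_Icc_of_monotone` repackaged): the record is the plain hull. [folklore] -/
theorem of_fires_ends
    (hmono : ∀ i I J, S₁ i = some I → S₂ i = some J →
      MonotoneOn (fun u => p u i) (Icc a b) ∨ AntitoneOn (fun u => p u i) (Icc a b))
    (ha : S₁.Mem (p a)) (hb : S₂.Mem (p b)) (h₁ : r.fires S₁ = true) (h₂ : r.fires S₂ = true) :
    IntervalCert S₁ S₂ (S₁.hull S₂) p a b r where
  path := Skel.mem_hull_on_Icc_of_monotone hmono ha hb
  fires := Row.fires_hull h₁ h₂
  incl_left := Skel.incl_hull_left S₁ S₂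
  incl_right := Skel.incl_hull_right S₁ S₂

/-- **Constructor — sign-definite coordinates, row firing on the HULL record** (weaker than firing at
both ends). [folklore] -/
theorem of_fires_hull
    (hmono : ∀ i I J, S₁ i = some I → S₂ i = some J →
      MonotoneOn (fun u => p u i) (Icc a b) ∨ AntitoneOn (fun u => p u i) (Icc a b))
    (ha : S₁.Mem (p a)) (hb : S₂.Mem (p b)) (h : r.fires (S₁.hull S₂) = true) :
    IntervalCert S₁ S₂ (S₁.hull S₂) p a b r where
  path := Skel.mem_hull_on_Icc_of_monotone hmono ha hb
  fires := h
  incl_left := Skel.incl_hull_left S₁ S₂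
  incl_right := Skel.incl_hull_right S₁ S₂

/-- **Constructor — the PADDED record** (coordinates without a sign, §P.12(b)): every coordinate
present in both point skeletons stays within `pad i` of the hull of its two end values along
`[a, b]`, and the row fires on the padded hull. [folklore] -/
theorem of_near_ends {pad : ι → ℚ≥0}
    (hnear : ∀ i I J, S₁ i = some I → S₂ i = some J → ∀ u ∈ Icc a b,
      p u i ∈ Icc (min (p a i) (p b i) - ((pad i : ℚ) : ℝ)) (max (p a i) (p b i) + ((pad i : ℚ) : ℝ)))
    (ha : S₁.Mem (p a)) (hb : S₂.Mem (p b)) (h : r.fires (S₁.hullPad S₂ pad) = true) :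
    IntervalCert S₁ S₂ (S₁.hullPad S₂ pad) p a b r where
  path := fun u hu =>
    Skel.mem_hullPad_of_near_ends ha hb fun i I J hI hJ => hnear i I J hI hJ u hu
  fires := h
  incl_left := Skel.incl_hullPad_left S₁ S₂ pad
  incl_right := Skel.incl_hullPad_right S₁ S₂ pad

/-- **Constructor — mod-1's `Box.hull` record** (§P.12(f)): two point boxes `B₁ ∋ p a`,
`B₂ ∋ p b`, every coordinate determined by both monotone or antitone on `[a, b]`, and a row firing
on the skeleton of `B₁.hull B₂`. [folklore] -/
theorem of_box_hull {B₁ B₂ : Box ι}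
    (hmono : ∀ i e f, B₁ i = some e → B₂ i = some f →
      MonotoneOn (fun u => p u i) (Icc a b) ∨ AntitoneOn (fun u => p u i) (Icc a b))
    (ha : B₁.Mem (p a)) (hb : B₂.Mem (p b)) (h : r.fires (B₁.hull B₂).skel = true) :
    IntervalCert B₁.skel B₂.skel (B₁.hull B₂).skel p a b r where
  path := fun u hu => by
    refine (Box.skel_hull_incl B₁ B₂).mem_of_mem
      (Skel.mem_hull_on_Icc_of_monotone (fun i I J hI hJ => ?_)
        ((B₁.mem_iff_skel_mem _).1 ha) ((B₂.mem_iff_skel_mem _).1 hb) u hu)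
    unfold Box.skel at hI hJ
    rcases h1 : B₁ i with _ | e
    · simp [h1] at hI
    · rcases h2 : B₂ i with _ | f
      · simp [h2] at hJ
      · exact hmono i e f h1 h2
  fires := h
  incl_left := (Skel.incl_hull_left _ _).trans (Box.skel_hull_incl B₁ B₂)
  incl_right := (Skel.incl_hull_right _ _).trans (Box.skel_hull_incl B₁ B₂)

end IntervalCert

/-- The reach's row fires on the computed point's box, so that column is routed to the reach word.
[folklore] -/
theorem ReachCert.route_point {S H : Skel ι} {p : ℝ → ι → ℝ} {a b : ℝ} {r : Row ι ω}
    {T : List (Row ι ω)} (hT : Consistent T) (hr : r ∈ T) (c : ReachCert S H p a b r) :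
    route T S = .table r.out :=
  route_table_of_fires hT hr (Row.fires_mono c.incl c.fires)

/-! ### §3b A NESTED one-parameter family of records (the DERIVED columns of §P.10(ix)) -/

/-- **Constructor — NESTED FAMILY of records.** Every pressure `u ∈ [a, b]` carries its own record
`F u` (e.g. the P = 0 record transported by one admitted monotone trend, `router/INFLATION-RULES.md`
§P.10(ii)/(ix)) which (i) admits the true parameter vector `p u` — the modelling claim of that
derived column — and (ii) sits inside the interval record `H` (`(F u).Incl H`: `H` inflates every
member); the two point skeletons sit inside `H` and the row fires on `H`. Then the sub-interval is
certified: the word holds at every `u`, with NO interpolation pad (the family, not a sensitivity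
class, supplies the path). [folklore] -/
theorem IntervalCert.of_nested_family {S₁ S₂ H : Skel ι} {F : ℝ → Skel ι} {p : ℝ → ι → ℝ}
    {a b : ℝ} {r : Row ι ω} (hfam : ∀ u ∈ Icc a b, (F u).Incl H)
    (hclaim : ∀ u ∈ Icc a b, (F u).Mem (p u)) (h₁ : S₁.Incl H) (h₂ : S₂.Incl H)
    (h : r.fires H = true) : IntervalCert S₁ S₂ H p a b r where
  path := fun u hu => (hfam u hu).mem_of_mem (hclaim u hu)
  fires := h
  incl_left := h₁
  incl_right := h₂

/-- **Nested family inside the HULL of its two end members, row firing at both ends** (the organics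
instance: a one-sided widening monotone in `P` keeps every intermediate record inside the far-end
record, hence inside the hull): the sub-interval is certified on `S₁.hull S₂`. [folklore] -/
theorem IntervalCert.of_nested_family_hull {S₁ S₂ : Skel ι} {F : ℝ → Skel ι} {p : ℝ → ι → ℝ}
    {a b : ℝ} {r : Row ι ω} (hfam : ∀ u ∈ Icc a b, (F u).Incl (S₁.hull S₂))
    (hclaim : ∀ u ∈ Icc a b, (F u).Mem (p u)) (hS₁ : r.fires S₁ = true)
    (hS₂ : r.fires S₂ = true) : IntervalCert S₁ S₂ (S₁.hull S₂) p a b r :=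
  IntervalCert.of_nested_family hfam hclaim (Skel.incl_hull_left S₁ S₂)
    (Skel.incl_hull_right S₁ S₂) (Row.fires_hull hS₁ hS₂)

/-- **A family nested in ONE end record** (every member inside `S₂`, e.g. a widening that only
grows toward `b`): it is nested in the hull, so `of_nested_family_hull` applies. [folklore] -/
theorem IntervalCert.of_nested_in_right {S₁ S₂ : Skel ι} {F : ℝ → Skel ι} {p : ℝ → ι → ℝ}
    {a b : ℝ} {r : Row ι ω} (hfam : ∀ u ∈ Icc a b, (F u).Incl S₂)
    (hclaim : ∀ u ∈ Icc a b, (F u).Mem (p u)) (hS₁ : r.fires S₁ = true)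
    (hS₂ : r.fires S₂ = true) : IntervalCert S₁ S₂ (S₁.hull S₂) p a b r :=
  IntervalCert.of_nested_family_hull (fun u hu => (hfam u hu).trans (Skel.incl_hull_right S₁ S₂))
    hclaim hS₁ hS₂

end Router

end Summit.Ventures.CertifiedManyBodySolver.Downfold
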